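import Summits.MatrixMultiplication.MatrixMultiplication.Theses.LevelGradedCohnUmans
import Summits.MatrixMultiplication.MatrixMultiplication.Theorems.GradedPricing.Negative.LoadBearing
import Summits.MatrixMultiplication.MatrixMultiplication.Theorems.GradedPricing.Negative.LeftInvariance
import Literature.Computability.AlgebraicComplexity.GroupAlgebraTensor
import Literature.Computability.AlgebraicComplexity.BCGPUInfiniteGroupsProofs
import Literature.RepresentationTheory.FiniteGroups.WedderburnBlocks
import Literature.RepresentationTheory.FiniteGroups.FourierInversionIdentity

/-!
# Line `separator-restriction-block-simplicity` for crux `LevelGradedCohnUmans.GradedPricing`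
# (stmt-MatrixMultiplication-7611) — crux-plan skeleton (planner, 2026-08-16, round 1)

THE LINE (idea card `Cruxes/GradedPricing/Ideas/separator-restriction-block-simplicity.md`, triage
r1-1/2/3: pass). Fix Wedderburn coordinates `φ : ℂ[G] ≃ₐ ∏ᵢ ℂ^{dᵢ×dᵢ}` (`exists_algEquiv_pi_matrix`).
Each separator `f = f_{x₀z₀} ∈ J` is used only through its READ-OUT functional on `ℂ[G]`,
`u ↦ Σ_g u_g f(g)`.

* `stub_readoutVanishes` (V, the lever): `J` bi-invariant, `f ∈ J`, `χᵢ ∉ J` ⟹ the read-out of `f`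
  vanishes on the whole `i`-th block `φ⁻¹(0,…,ℂ^{dᵢ×dᵢ},…,0)`. (Bi-invariance makes
  `T(J) = {Σ_g f(g) g⁻¹}` a TWO-sided ideal; two-sided ideals of `∏ ℂ^{dᵢ×dᵢ}` are sub-products
  because each block is a simple ring — the card's first lemma
  `twoSidedIdeal_blockAlgebra_eq_subproduct`, PROVED sorry-free in
  `Cruxes/GradedPricing/SketchIdeator2.lean` (ll. 92–143, copy it next to the stub proof);
  the unit of block `i` transports back to `(dᵢ/|G|)·χᵢ` by Fourier inversion at `1`.)
* `stub_supportRestriction` (R, J-free "support pricing", the card's Transfer C⁺ in tensor form):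
  a separator family whose read-outs vanish off the blocks `σ(Fin p)` realises
  `⟨X, Y, Z⟩ = matMulTensorOn ℂ X Y Z` as a restriction of `⊕_j ⟨d_{σ j}, d_{σ j}, d_{σ j}⟩`
  (native orientation `x⁻¹y · y'⁻¹z`, no TPP clause, no quotient algebra).
* PROVED from (V)+(R): `sep_tensorRestrictsTo_gradedBlocks` — the ω-FREE PARENT of the crux,
  `J`-separated ⟹ `⟨X,Y,Z⟩ ≤ ⊕_{i ∈ S} ⟨dᵢ,dᵢ,dᵢ⟩` for the visible blocks `S = {i : χᵢ ∈ J}`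
  (enumerated by `S.orderEmbOfFin`; what `TokenWall` 7616 wants); PROVED glue:
  `card_rpow_omega_le_of_restrictsTo_matMulDirectSum` (the tensor-power sandwich = tree
  `rpow_omega_le_sum_rpow_of_restrictsTo` + relabelling + the no-block corner) and
  `sum_blockDegrees_rpow_le_finsum_irrChars_inter` (budget: visible blocks are distinct irreducible
  characters lying in `J`).
* `GradedPricing_of` — the composition, concluding the crux BY NAME: graded restriction, then
  sandwich ⟹ `(|X||Y||Z|)^{ω/3} ≤ Σ_{i∈S} dᵢ^ω`, then budget ⟹ `≤ Σᶠ_{χ ∈ Irr G ∩ J} χ(1)^ω`.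

DISPROOF / NEGATIVE LEMMAS honoured (imported above; `Cruxes/GradedPricing/Disproof.lean` cycle 1):
`gradedPricing_false_without_biInv`, `gradedPricing_false_with_leftInv_only` — bi-invariance is
consumed TWO-sidedly and only in (V) (with left-invariance alone (V) is false: `S₃`, `J_col`);
`gradedPricing_false_without_ones` / `_without_zeros` — both halves of the pattern are consumed in
(R) (the 1's give the `matMul` entries, the 0's the vanishing elsewhere); `gradedPricing_attained` /
`not_gradedPricing_strict` — the line proves `≤` with constant 1; exponent is `ω` throughout
(never the refuted cube exponent of `not_gradedCubePacking`). No stub is an instance of a landed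
Negative lemma: (V) and (R) are implications ABOUT a fixed `φ`, not pricing inequalities.

Every stub is stated over TREE VOCABULARY ONLY (no local `def`, no notation), so each can be landed
verbatim as `Summits/MatrixMultiplication/MatrixMultiplication/Theorems/<Name>.lean`
(`--supports stmt-MatrixMultiplication-7611`) without importing this workfile.
-/

noncomputable section

open scoped BigOperators
open Literature.Computability.AlgebraicComplexity Literature.RepresentationTheory.FiniteGroups

namespace Summit.MatrixMultiplication.MatrixMultiplication.Cruxes.GradedPricing.SeparatorRestrictionBlockSimplicity

set_option linter.dupNamespace false

/-! ## The stubs -/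

/-- **Stub (V) — READ-OUT VANISHING on invisible blocks** (the lever; size M).
For a bi-invariant test space `J ≤ ℂ^G`, a test `f ∈ J` and a Wedderburn block `i` whose
character `χᵢ = tr (φ ·)ᵢ` does NOT lie in `J`, the read-out functional `u ↦ Σ_g u_g f(g)` of `f`
kills the whole block `φ⁻¹(ℂ^{dᵢ×dᵢ})`.
Why true — Route A (the card): `T f := Σ_g f(g)·g⁻¹` satisfies `Σ_g u_g f(g) = (u · T f)(1)` and
`a · T f · b = T (f(b · a))`, so bi-invariance makes `T(J)` a two-sided ideal of `ℂ[G]`; by block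
simplicity (`twoSidedIdeal_blockAlgebra_eq_subproduct`, PROVED in `Cruxes/GradedPricing/SketchIdeator2.lean`
ll. 92–143 from Mathlib `IsSimpleRing.matrix`), `φ(T J) = ∏_{i ∈ S'}` blocks; if `i ∈ S'` then
`φ⁻¹(eᵢ) = T f₀` with `f₀ ∈ J`, and Fourier inversion at `1` (`card_mul_coeff_one_eq_sum_trace`
applied to `g · φ⁻¹(eᵢ)`) gives `|G|·f₀ = dᵢ·χᵢ`, contradicting `χᵢ ∉ J`; so `i ∉ S'` and
`u · T f ∈ φ⁻¹(block i) ∩ T(J) = 0` for `u = φ⁻¹(0,…,M,…,0)`. Route B (≈ card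
`matrix-unit-sandwich`, kernel-checked in `SketchIdeator1.lean`): for a matrix unit `E_{ab}` of
block `i` with `N := Σ_g (φ⁻¹E_{ab})_g f(g) ≠ 0`, the generalized bi-translates
`g ↦ Σ_h (φ⁻¹E_{ac} · g · φ⁻¹E_{cb})_h f(h)` lie in `J` and sum over `c` to `N · χᵢ`; then
linearity in `M`. Uses bi-invariance TWO-sidedly: with left-invariance only the statement is false
(`S₃`, `J_col`, `gradedPricing_false_with_leftInv_only`). -/
theorem stub_readoutVanishes {G : Type} [Group G] [Fintype G]
    {r : ℕ} {d : Fin r → ℕ} [∀ i, NeZero (d i)] (φ : MonoidAlgebra ℂ G ≃ₐ[ℂ] BlockAlgebraC d)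
    (J : Submodule ℂ (G → ℂ)) (hJ : ∀ f ∈ J, ∀ a b : G, (fun g : G => f (a * g * b)) ∈ J)
    (f : G → ℂ) (hf : f ∈ J) (i : Fin r)
    (hi : ((blockRep φ i).character : G → ℂ) ∉ J) (M : Matrix (Fin (d i)) (Fin (d i)) ℂ) :
    ∑ g, (φ.symm (Pi.single i M)).coeff g * f g = 0 := by
  sorry

/-- **Stub (R) — SUPPORT RESTRICTION** (J-free graded restriction, the card's Transfer C⁺ in
tensor form; size M). Let `F x₀ z₀ : G → ℂ` be ANY family of separators for `(X, Y, Z)` in the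
route's convention — `F x₀ z₀ (x⁻¹ y y'⁻¹ z) = [x = x₀ ∧ y = y' ∧ z = z₀]` on `X × Y × Y × Z` — and
let `σ : Fin p → Fin r` be an injective family of Wedderburn blocks off which every read-out
`u ↦ Σ_g u_g F_{x₀z₀}(g)` vanishes. Then the matrix multiplication tensor with rows `X`, inner
indices `Y`, columns `Z` is a restriction of `⊕_j ⟨d_{σ j}, d_{σ j}, d_{σ j}⟩`.
Why true: compute inside the sub-block algebra `A_σ = ∏_j ℂ^{d_{σ j} × d_{σ j}}` (basis
`blockBasis ℂ (d ∘ σ)`, structure tensor `= matMulDirectSum` by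
`structureTensor_blockBasis_eq_matMulDirectSum`) with `α(x,y) = π_σ φ(x⁻¹y)`,
`β(y',z) = π_σ φ(y'⁻¹z)` (`π_σ` the projection, an algebra hom) and the linear read-out
`γ_{x₀z₀}(w) = Σ_j Σ_g (φ⁻¹(ι_{σ j} w_j))_g F_{x₀z₀}(g)`; the vanishing hypothesis gives
`γ(π_σ φ u) = Σ_g u_g F(g)` for all `u ∈ ℂ[G]` (decompose `φ u = Σᵢ ιᵢ (φ u)ᵢ`, reindex the
visible blocks along `σ`), hence `γ(α β) = F_{x₀z₀}(x⁻¹ y y'⁻¹ z)` = the `⟨X,Y,Z⟩` entry, and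
`tensorRestrictsTo_structureTensor_of_factors` (BCGPUInfiniteGroupsProofs) concludes. Consumes BOTH
halves of the separation pattern (`gradedPricing_false_without_ones/_zeros`). -/
theorem stub_supportRestriction {G : Type} [Group G] [Fintype G] [DecidableEq G]
    {r : ℕ} {d : Fin r → ℕ} (φ : MonoidAlgebra ℂ G ≃ₐ[ℂ] BlockAlgebraC d)
    (X Y Z : Finset G) (F : G → G → G → ℂ)
    (hF : ∀ x₀ ∈ X, ∀ z₀ ∈ Z, ∀ x ∈ X, ∀ y ∈ Y, ∀ y' ∈ Y, ∀ z ∈ Z,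
      (x = x₀ ∧ y = y' ∧ z = z₀ → F x₀ z₀ (x⁻¹ * y * y'⁻¹ * z) = 1) ∧
      (¬ (x = x₀ ∧ y = y' ∧ z = z₀) → F x₀ z₀ (x⁻¹ * y * y'⁻¹ * z) = 0))
    {p : ℕ} (σ : Fin p → Fin r) (hσ : Function.Injective σ)
    (hvan : ∀ x₀ ∈ X, ∀ z₀ ∈ Z, ∀ i : Fin r, i ∉ Set.range σ →
      ∀ M : Matrix (Fin (d i)) (Fin (d i)) ℂ,
        ∑ g, (φ.symm (Pi.single i M)).coeff g * F x₀ z₀ g = 0) :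
    TensorRestrictsTo
      (matMulDirectSum ℂ (fun j => d (σ j)) (fun j => d (σ j)) (fun j => d (σ j)))
      (matMulTensorOn ℂ X Y Z) := by
  sorry

/-! ## Proved from the stubs: the ω-free parent of the crux -/

/-- **Graded restriction** (PROVED from (V)+(R); the ω-free parent of `GradedPricing`): for a
bi-invariant `J`, a `J`-separated triple `(X, Y, Z)` (the crux's clause verbatim) and the set `S`
of VISIBLE blocks (`i ∈ S ↔ χᵢ ∈ J`), enumerated increasingly by `S.orderEmbOfFin`,
`⟨X, Y, Z⟩ ≤ ⊕_{i ∈ S} ⟨dᵢ, dᵢ, dᵢ⟩`. (Choose the separators inside `J`; by (V) their read-outs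
vanish off `S`; apply (R) with `σ = S.orderEmbOfFin`.) -/
theorem sep_tensorRestrictsTo_gradedBlocks {G : Type} [Group G] [Fintype G] [DecidableEq G]
    {r : ℕ} {d : Fin r → ℕ} [∀ i, NeZero (d i)] (φ : MonoidAlgebra ℂ G ≃ₐ[ℂ] BlockAlgebraC d)
    (J : Submodule ℂ (G → ℂ)) (hJ : ∀ f ∈ J, ∀ a b : G, (fun g : G => f (a * g * b)) ∈ J)
    (X Y Z : Finset G)
    (hsep : ∀ x₀ ∈ X, ∀ z₀ ∈ Z, ∃ f ∈ J, ∀ x ∈ X, ∀ y ∈ Y, ∀ y' ∈ Y, ∀ z ∈ Z,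
      (x = x₀ ∧ y = y' ∧ z = z₀ → f (x⁻¹ * y * y'⁻¹ * z) = 1) ∧
      (¬ (x = x₀ ∧ y = y' ∧ z = z₀) → f (x⁻¹ * y * y'⁻¹ * z) = 0))
    (S : Finset (Fin r)) (hS : ∀ i, i ∈ S ↔ ((blockRep φ i).character : G → ℂ) ∈ J) :
    TensorRestrictsTo
      (matMulDirectSum ℂ (fun j => d (S.orderEmbOfFin rfl j)) (fun j => d (S.orderEmbOfFin rfl j))
        (fun j => d (S.orderEmbOfFin rfl j)))
      (matMulTensorOn ℂ X Y Z) := by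
  classical
  -- the separators, chosen inside `J`
  choose! F hFJ hF using hsep
  -- (V): every separator read-out vanishes on the invisible blocks
  have hvan : ∀ x₀ ∈ X, ∀ z₀ ∈ Z, ∀ i : Fin r, i ∉ Set.range (S.orderEmbOfFin rfl) →
      ∀ M : Matrix (Fin (d i)) (Fin (d i)) ℂ,
        ∑ g, (φ.symm (Pi.single i M)).coeff g * F x₀ z₀ g = 0 := by
    intro x₀ hx₀ z₀ hz₀ i hi M
    refine stub_readoutVanishes φ J hJ (F x₀ z₀) (hFJ x₀ hx₀ z₀ hz₀) i ?_ M
    rw [Finset.range_orderEmbOfFin, Finset.mem_coe, hS] at hi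
    exact hi
  -- (R): restriction through the visible blocks
  exact stub_supportRestriction φ X Y Z F hF (S.orderEmbOfFin rfl) (S.orderEmbOfFin rfl).injective
    hvan

/-! ## Proved glue: the sandwich and the budget -/

/-- **The block sandwich** (PROVED): a restriction `⟨X, Y, Z⟩ ≤ ⊕_j ⟨d'_j, d'_j, d'_j⟩` with
`d'_j ≥ 1` prices the triple, `(|X||Y||Z|)^{ω/3} ≤ Σ_j d'_j^ω` — the tree's tensor-power argument
`rpow_omega_le_sum_rpow_of_restrictsTo` (BCGPU24 Thm 2.2 proof, p. 13 = Cohn–Umans 2003 Thm 4.1)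
after relabelling `↥X ≃ Fin |X|` etc.; with no blocks at all the source format is empty, so the
restricted tensor vanishes and the volume is `0`. -/
theorem card_rpow_omega_le_of_restrictsTo_matMulDirectSum {p : ℕ} (d' : Fin p → ℕ)
    [∀ j, NeZero (d' j)] {G : Type} [DecidableEq G] (X Y Z : Finset G)
    (h : TensorRestrictsTo (matMulDirectSum ℂ d' d' d') (matMulTensorOn ℂ X Y Z)) :
    ((X.card * Y.card * Z.card : ℕ) : ℝ) ^ (omega ℂ / 3) ≤ ∑ j, (d' j : ℝ) ^ omega ℂ := by
  have hω0 : 0 < omega ℂ := zero_lt_two.trans_le (omega_two_le (K := ℂ))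
  rcases Nat.eq_zero_or_pos (X.card * Y.card * Z.card) with hq | hq
  · rw [hq, Nat.cast_zero, Real.zero_rpow (div_pos hω0 three_pos).ne']
    exact Finset.sum_nonneg fun i _ => Real.rpow_nonneg (Nat.cast_nonneg _) _
  rcases Nat.eq_zero_or_pos p with hp | hp
  · -- no blocks: the source format is empty, but a positive-volume `⟨X,Y,Z⟩` has a non-zero entry
    exfalso
    subst hp
    have hX : X.Nonempty := Finset.card_pos.1 (Nat.pos_of_ne_zero fun h0 => by simp [h0] at hq)
    have hY : Y.Nonempty := Finset.card_pos.1 (Nat.pos_of_ne_zero fun h0 => by simp [h0] at hq)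
    have hZ : Z.Nonempty := Finset.card_pos.1 (Nat.pos_of_ne_zero fun h0 => by simp [h0] at hq)
    obtain ⟨x, hx⟩ := hX
    obtain ⟨y, hy⟩ := hY
    obtain ⟨z, hz⟩ := hZ
    obtain ⟨A, B, C, hABC⟩ := h
    haveI : IsEmpty (Σ i : Fin 0, Fin (d' i) × Fin (d' i)) := ⟨fun k => Fin.elim0 k.1⟩
    have e := hABC (⟨x, hx⟩, ⟨z, hz⟩) (⟨x, hx⟩, ⟨y, hy⟩) (⟨y, hy⟩, ⟨z, hz⟩)
    simp at e
  · -- relabel the rows/columns by `Fin |X|, Fin |Y|, Fin |Z|` and run the tensor-power argument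
    have hres : TensorRestrictsTo (matMulDirectSum ℂ d' d' d')
        (matMulTensor ℂ X.card Y.card Z.card) := by
      refine h.trans ?_
      have key : matMulTensor ℂ X.card Y.card Z.card = fun a b c => matMulTensorOn ℂ X Y Z
          (Prod.map X.equivFin.symm Z.equivFin.symm a) (Prod.map X.equivFin.symm Y.equivFin.symm b)
          (Prod.map Y.equivFin.symm Z.equivFin.symm c) := by
        funext a b c
        exact (matMulTensorOn_reindex (K := ℂ) X.equivFin.symm Y.equivFin.symm Z.equivFin.symm
          a b c).symm
      rw [key]
      exact tensorRestrictsTo_precomp _ _ _ _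
    exact rpow_omega_le_sum_rpow_of_restrictsTo d' hp hres

/-- **The budget** (PROVED): the blocks `σ j` are pairwise distinct irreducible characters
(`character_blockRep_injective`, `isIrreducible_blockRep`) lying in `J`, and `χ_{σ j}(1) = d_{σ j}`,
so `Σ_j d_{σ j}^s ≤ Σᶠ_{χ ∈ Irr G ∩ J} χ(1)^s` (finite sum: `irrChars_finite_holds`). -/
theorem sum_blockDegrees_rpow_le_finsum_irrChars_inter {G : Type} [Group G] [Fintype G]
    {r : ℕ} {d : Fin r → ℕ} [∀ i, NeZero (d i)] (φ : MonoidAlgebra ℂ G ≃ₐ[ℂ] BlockAlgebraC d)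
    (J : Submodule ℂ (G → ℂ)) {p : ℕ} (σ : Fin p → Fin r) (hσ : Function.Injective σ)
    (hS : ∀ j, ((blockRep φ (σ j)).character : G → ℂ) ∈ J) (s : ℝ) :
    ∑ j, (d (σ j) : ℝ) ^ s ≤ ∑ᶠ χ ∈ irrChars G ∩ (J : Set (G → ℂ)), (χ 1).re ^ s := by
  classical
  have hfin : (irrChars G ∩ (J : Set (G → ℂ))).Finite :=
    (irrChars_finite_holds G).subset Set.inter_subset_left
  rw [finsum_mem_eq_finite_toFinset_sum _ hfin]
  set χ : Fin p → (G → ℂ) := fun j => (blockRep φ (σ j)).character with hχ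
  have hinj : Function.Injective χ := fun j j' h => hσ (character_blockRep_injective φ h)
  have hmem : ∀ j, χ j ∈ hfin.toFinset := fun j => by
    rw [Set.Finite.mem_toFinset]
    exact ⟨⟨Fin (d (σ j)) → ℂ, inferInstance, inferInstance, inferInstance, blockRep φ (σ j),
      isIrreducible_blockRep φ (σ j), rfl⟩, hS j⟩
  have hdeg : ∀ j, ((χ j 1).re : ℝ) = d (σ j) := fun j => by
    simp [hχ, Representation.char_one]
  calc ∑ j, (d (σ j) : ℝ) ^ s = ∑ ψ ∈ Finset.univ.image χ, (ψ 1).re ^ s := by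
        rw [Finset.sum_image fun i _ j _ h => hinj h]
        exact Finset.sum_congr rfl fun i _ => by rw [hdeg]
    _ ≤ ∑ ψ ∈ hfin.toFinset, (ψ 1).re ^ s := by
        refine Finset.sum_le_sum_of_subset_of_nonneg (fun ψ hψ => ?_) (fun ψ hψ _ => ?_)
        · obtain ⟨i, -, rfl⟩ := Finset.mem_image.1 hψ
          exact hmem i
        · rw [Set.Finite.mem_toFinset] at hψ
          obtain ⟨dψ, -, hdψ⟩ := IsIrrChar.exists_apply_one (G := G) hψ.1
          rw [hdψ]
          exact Real.rpow_nonneg (by simp) _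

/-! ## The composition: the stubs conclude the crux BY NAME -/

/-- **Composition** `(V) + (R) + sandwich + budget ⟹ GradedPricing`: in Wedderburn coordinates
`φ` (`exists_algEquiv_pi_matrix`), let `S = {i : χᵢ ∈ J}` be the visible blocks; the graded
restriction `sep_tensorRestrictsTo_gradedBlocks` ((V)+(R)) gives `⟨X,Y,Z⟩ ≤ ⊕_{i ∈ S} ⟨dᵢ,dᵢ,dᵢ⟩`,
the sandwich `(|X||Y||Z|)^{ω/3} ≤ Σ_{i∈S} dᵢ^ω`, and the budget bounds this by
`Σᶠ_{χ ∈ Irr G ∩ J} χ(1)^ω`. No sorry outside the two stubs. -/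
theorem GradedPricing_of :
    Summit.MatrixMultiplication.MatrixMultiplication.Theses.LevelGradedCohnUmans.GradedPricing := by
  intro G _ _ J hJ X Y Z hsep
  classical
  -- Wedderburn coordinates
  obtain ⟨r, d, hd, ⟨φ⟩⟩ := exists_algEquiv_pi_matrix G
  -- the visible blocks `S = {i : χᵢ ∈ J}`
  set S : Finset (Fin r) :=
    Finset.univ.filter fun i => ((blockRep φ i).character : G → ℂ) ∈ J with hS
  have hmemS : ∀ i, i ∈ S ↔ ((blockRep φ i).character : G → ℂ) ∈ J := fun i => by simp [hS]
  -- graded restriction ((V)+(R)), sandwich, budget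
  have hres := sep_tensorRestrictsTo_gradedBlocks φ J hJ X Y Z hsep S hmemS
  have hvis : ∀ j, ((blockRep φ (S.orderEmbOfFin rfl j)).character : G → ℂ) ∈ J := fun j =>
    (hmemS _).1 (Finset.orderEmbOfFin_mem S rfl j)
  exact (card_rpow_omega_le_of_restrictsTo_matMulDirectSum (fun j => d (S.orderEmbOfFin rfl j))
    X Y Z hres).trans
    (sum_blockDegrees_rpow_le_finsum_irrChars_inter φ J (S.orderEmbOfFin rfl)
      (S.orderEmbOfFin rfl).injective hvis (omega ℂ))

end Summit.MatrixMultiplication.MatrixMultiplication.Cruxes.GradedPricing.SeparatorRestrictionBlockSimplicity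

end
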